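import Literature.Geometry.Lorentzian.BackgroundChartCalculus
import Literature.Geometry.Lorentzian.NearFramedChart
import HarnessLib

/-!
# Charts pinched in a frame field: immersion and orientation lemmas

Framed twins of `BackgroundChartCalculus.lean` §4 for the compactness theorem relative to a framed
background (`TameChartCompactnessFramed.lean`): a smooth chart map `Ψ : ↥O → 𝓢` whose components
READ IN THE FRAME `𝔉.A⁻¹` are `C⁰`-close to `η` (`‖framedBilin (Ψ^* g) A⁻¹ − η‖ < 1`) has
nondegenerate components, hence is a local diffeomorphism; it pushes the frame vector `A⁻¹∂₀` to a
timelike vector, so on a connected domain the orientation of `dΨ(A⁻¹∂₀)` is that of one point — for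
which we prove the one-sign lemma for a VARIABLE continuous coordinate vector field
(`isFutureDirected_mfderiv_apply_of_isPreconnected`, twin of
`isFutureDirected_mfderiv_of_isPreconnected`).

## References
* B. O'Neill, *Semi-Riemannian geometry*, Academic Press 1983, Ch. 5, Lemma 5.26 ff., p. 145. [ONeill1983]
-/

noncomputable section

open Set Filter TopologicalSpace Bundle Function
open scoped Manifold ContDiff Topology

universe u

namespace Literature.Geometry.Lorentzian

namespace Spacetime

variable (𝓣 : Spacetime.{u} 4)

/-- **One sign on a connected set, variable coordinate field.** For `Ψ : E4 → 𝓣` of class `C^∞` on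
an open `O`, a vector field `V` continuous on `O`, a preconnected `S ⊆ O` with `dΨ_x(V x)` CAUSAL on
`S`: future-directed at one point of `S` ⇒ future-directed on `S`.
[cite: ONeill1983, Ch. 5, Lemma 5.26 ff., p. 145] -/
theorem isFutureDirected_mfderiv_apply_of_isPreconnected {Ψ : E4 → 𝓣.carrier} {O : Set E4}
    (hO : IsOpen O) (hΨ : ContMDiffOn 𝓘(ℝ, E4) (𝓡 4) ∞ Ψ O) {S : Set E4}
    (hS : IsPreconnected S) (hSO : S ⊆ O) (V : E4 → E4) (hV : ContinuousOn V O)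
    (hc : ∀ x ∈ S, 𝓣.metric.IsCausal (mfderiv 𝓘(ℝ, E4) (𝓡 4) Ψ x (V x))) {x₁ : E4} (hx₁ : x₁ ∈ S)
    (h₁ : 𝓣.timeOrientation.IsFutureDirected (mfderiv 𝓘(ℝ, E4) (𝓡 4) Ψ x₁ (V x₁))) :
    ∀ x ∈ S, 𝓣.timeOrientation.IsFutureDirected (mfderiv 𝓘(ℝ, E4) (𝓡 4) Ψ x (V x)) := by
  let β : E4 → ℝ := fun x ↦ 𝓣.metric.val (Ψ x) (𝓣.timeOrientation.vectorField (Ψ x))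
    (mfderiv 𝓘(ℝ, E4) (𝓡 4) Ψ x (V x))
  have hΨd : ∀ x ∈ O, MDifferentiableAt 𝓘(ℝ, E4) (𝓡 4) Ψ x := fun x hx ↦
    ((hΨ x hx).contMDiffAt (hO.mem_nhds hx)).mdifferentiableAt (by simp)
  have hβc : ContinuousOn β O := by
    refine hO.continuousOn_iff.2 fun {a} ha ↦ ?_
    set c := chartAt E4 (Ψ a) with hc
    set O' : Set E4 := O ∩ Ψ ⁻¹' c.source with hO'
    have hO'o : IsOpen O' := hΨ.continuousOn.isOpen_inter_preimage hO c.open_source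
    have haO' : a ∈ O' := ⟨ha, mem_chart_source E4 (Ψ a)⟩
    let θ : E4 → E4 := c ∘ Ψ
    let Vc : E4 → E4 := fun x ↦ fderiv ℝ θ x (V x)
    let W : E4 → E4 := fun x ↦ 𝓣.timeOrientation.chartTime (Ψ a) (Ψ x)
    let m : E4 → E4 →L[ℝ] E4 →L[ℝ] ℝ := fun x ↦ 𝓣.metricInCoords c.symm (c (Ψ x))
    have hθs : ContDiffOn ℝ ∞ θ O' := by
      rw [← contMDiffOn_iff_contDiffOn]
      exact (contMDiffOn_chart (x := Ψ a)).comp (hΨ.mono inter_subset_left) fun x hx ↦ hx.2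
    have hVcc : ContinuousOn Vc O' :=
      (hθs.continuousOn_fderiv_of_isOpen hO'o (by exact_mod_cast le_top)).clm_apply
        (hV.mono inter_subset_left)
    have hWc : ContinuousOn W O' :=
      (𝓣.timeOrientation.contMDiffOn_chartTime (by exact_mod_cast le_top) (Ψ a)).continuousOn.comp
        (hΨ.continuousOn.mono inter_subset_left) fun _ hx ↦ hx.2
    have hmc : ContinuousOn m O' :=
      (𝓣.contDiffOn_metricInCoords_chartAt_symm (Ψ a)).continuousOn.comp
        (c.continuousOn.comp (hΨ.continuousOn.mono inter_subset_left) fun _ hx ↦ hx.2)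
        fun _ hx ↦ c.map_source hx.2
    have hcont : ContinuousOn (fun x ↦ m x (W x) (Vc x)) O' := (hmc.clm_apply hWc).clm_apply hVcc
    have heq : EqOn β (fun x ↦ m x (W x) (Vc x)) O' := by
      intro x hx
      have hz : Ψ x ∈ c.source := hx.2
      have hVcx : Vc x = mfderiv (𝓡 4) 𝓘(ℝ, E4) c (Ψ x) (mfderiv 𝓘(ℝ, E4) (𝓡 4) Ψ x (V x)) := by
        show fderiv ℝ (c ∘ Ψ) x (V x) = _
        rw [← mfderiv_eq_fderiv, mfderiv_comp x
          ((mdifferentiable_chart (Ψ a)).mdifferentiableAt hz) (hΨd x hx.1)]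
        rfl
      have hWx : W x = mfderiv (𝓡 4) 𝓘(ℝ, E4) c (Ψ x) (𝓣.timeOrientation.vectorField (Ψ x)) :=
        𝓣.chartTime_eq_mfderiv hz
      show _ = 𝓣.metricInCoords c.symm (c (Ψ x)) (W x) (Vc x)
      rw [hVcx, hWx, 𝓣.metricInCoords_chartAt_symm_apply_mfderiv hz]
    exact ((hcont.congr heq).continuousWithinAt haO').continuousAt (hO'o.mem_nhds haO')
  have hne : ∀ x ∈ S, β x ≠ 0 := fun x hx ↦
    𝓣.metric.val_ne_zero_of_isTimelike_of_isCausal (𝓣.timeOrientation.isTimelike (Ψ x)) (hc x hx)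
  have hneg₁ : β x₁ < 0 := h₁.2
  intro x hx
  refine ⟨hc x hx, ?_⟩
  show β x < 0
  rcases lt_or_gt_of_ne (hne x hx) with h | h
  · exact h
  · exfalso
    have hI := hS.intermediate_value hx₁ hx (hβc.mono hSO)
    obtain ⟨y, hy, hy0⟩ := hI ⟨hneg₁.le, h.le⟩
    exact hne y hy hy0

variable {O : Opens E4} (𝔉 : FrameField O)

/-- **Framed pinching ⇒ nondegenerate components**: if `‖framedBilin (metricInCoords ψ) A⁻¹ (y) − η‖ < 1`
at `y ∈ O` then `metricInCoords ψ y` is nondegenerate. [cite: ONeill1983, Ch. 5, Lemma 5.26] -/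
theorem metricInCoords_nondegenerate_of_norm_framed_sub_lt_one {ψ : E4 → 𝓣.carrier} {y : E4}
    (hy : y ∈ (O : Set E4)) (h : ‖framedBilin (𝓣.metricInCoords ψ) 𝔉.Ainv y - Minkowski.bilin‖ < 1) :
    ∀ v : E4, (∀ w : E4, 𝓣.metricInCoords ψ y v w = 0) → v = 0 := by
  intro v hv
  -- the framed form is nondegenerate; transport back through `A`
  have hnd : ∀ u : E4, (∀ w, framedBilin (𝓣.metricInCoords ψ) 𝔉.Ainv y u w = 0) → u = 0 :=
    fun u hu ↦ Minkowski.nondegenerate_of_spatial_pos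
      (fun a b ↦ framedBilin_symm 𝔉.Ainv (fun a b ↦ 𝓣.metricInCoords_symm ψ y a b) a b)
      (fun _ hu0 hu' ↦ Minkowski.apply_self_pos_of_norm_sub_bilin_lt_one h hu0 hu')
      (Minkowski.apply_basisVector_zero_neg_of_norm_sub_bilin_lt_one h) u hu
  have key := Minkowski.nondegenerate_comp (B := framedBilin (𝓣.metricInCoords ψ) 𝔉.Ainv y)
    (T := 𝔉.A y) (Tinv := 𝔉.Ainv y) hnd (𝔉.comp_Ainv y hy) (𝔉.Ainv_comp y hy) v fun w ↦ ?_
  · exact key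
  · rw [framedBilin_apply, 𝔉.Ainv_A_apply hy, 𝔉.Ainv_A_apply hy]
    exact hv w

/-- **A chart pinched in a frame is a local diffeomorphism** at points of `O` (smooth on `O`).
[cite: ONeill1983, Ch. 5, Lemma 5.26] -/
theorem isLocalDiffeomorphAt_of_norm_framed_sub_lt_one {ψ : E4 → 𝓣.carrier}
    (hψ : ContMDiffOn 𝓘(ℝ, E4) (𝓡 4) ∞ ψ O) {y : E4} (hy : y ∈ (O : Set E4))
    (h : ‖framedBilin (𝓣.metricInCoords ψ) 𝔉.Ainv y - Minkowski.bilin‖ < 1) :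
    IsLocalDiffeomorphAt 𝓘(ℝ, E4) (𝓡 4) ∞ ψ y :=
  𝓣.isLocalDiffeomorphAt_of_metricInCoords_nondegenerate O.2 hψ hy
    (𝓣.metricInCoords_nondegenerate_of_norm_framed_sub_lt_one 𝔉 hy h)

/-- **`A⁻¹ ∂₀` is pushed to a timelike vector by a chart pinched in the frame.**
[cite: ONeill1983, Ch. 5, Lemma 5.26] -/
theorem isTimelike_mfderiv_Ainv_basisVector_zero_of_norm_framed_sub_lt_one {ψ : E4 → 𝓣.carrier}
    {y : E4} (h : ‖framedBilin (𝓣.metricInCoords ψ) 𝔉.Ainv y - Minkowski.bilin‖ < 1) :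
    𝓣.metric.IsTimelike (mfderiv 𝓘(ℝ, E4) (𝓡 4) ψ y (𝔉.Ainv y (E4.basisVector 0))) := by
  have h1 := Minkowski.apply_basisVector_zero_neg_of_norm_sub_bilin_lt_one h
  rwa [framedBilin_apply, metricInCoords_apply] at h1

/-- The **framed deviation** of a subtype chart `Ψ : ↥O → 𝓢`: the components of
`Ψ ∘ (chartAt E4 x).symm` read in the frame `A⁻¹`, minus `η`. [cite: Petersen2006, Ch. 10 §3.2] -/
def framedDeviation (Ψ : O → 𝓣.carrier) (x : O) : E4 → E4 →L[ℝ] E4 →L[ℝ] ℝ :=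
  framedBilin (𝓣.metricInCoords (Ψ ∘ (chartAt E4 x).symm)) 𝔉.Ainv - fun _ ↦ Minkowski.bilin

/-- The framed deviation does not depend on the base point of the (inclusion) chart. [folklore] -/
theorem framedDeviation_eq (Ψ : O → 𝓣.carrier) (x x' : O) :
    𝓣.framedDeviation 𝔉 Ψ x = 𝓣.framedDeviation 𝔉 Ψ x' := rfl

/-- **Subtype-chart form of the local diffeomorphism property, framed pinching.**
[cite: ONeill1983, Ch. 5, Lemma 5.26] -/
theorem isLocalDiffeomorph_of_norm_framedDeviation_lt_one (Ψ : O → 𝓣.carrier)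
    (hΨ : ContMDiff 𝓘(ℝ, E4) (𝓡 4) ∞ Ψ) (x₀ : O)
    (h : ∀ y ∈ (O : Set E4), ‖𝓣.framedDeviation 𝔉 Ψ x₀ y‖ < 1) :
    IsLocalDiffeomorph 𝓘(ℝ, E4) (𝓡 4) ∞ Ψ := by
  intro z
  have hψ : ContMDiffOn 𝓘(ℝ, E4) (𝓡 4) ∞ (Ψ ∘ (chartAt E4 z).symm) O :=
    𝓣.contMDiffOn_comp_chartAt_symm (Minkowski.backgroundOn O) Ψ z hΨ
  have h1 : IsLocalDiffeomorphAt 𝓘(ℝ, E4) (𝓡 4) ∞ (Ψ ∘ (chartAt E4 z).symm) (z : E4) :=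
    𝓣.isLocalDiffeomorphAt_of_norm_framed_sub_lt_one 𝔉 hψ z.2 (h z z.2)
  have h2 : IsLocalDiffeomorphAt 𝓘(ℝ, E4) (𝓡 4) ∞
      ((Ψ ∘ (chartAt E4 z).symm) ∘ (Subtype.val : O → E4)) z :=
    IsLocalDiffeomorphAt.comp (hf := isLocalDiffeomorph_subtypeVal (I := 𝓘(ℝ, E4)) O z) (hg := h1)
  rwa [comp_chartAt_symm_comp_subtypeVal] at h2

/-- **Orientation of a chart pinched in a frame from its orientation at one point**: if
`dΨ(A⁻¹∂₀)` is future-directed at one point of the connected `O`, it is so everywhere on `O`.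
[cite: ONeill1983, Ch. 5, Lemma 5.26 ff., p. 145] -/
theorem isFutureDirected_mfderiv_Ainv_basisVector_zero_of_norm_framedDeviation_lt_one
    (hO : IsPreconnected (O : Set E4)) (Ψ : O → 𝓣.carrier) (hΨ : ContMDiff 𝓘(ℝ, E4) (𝓡 4) ∞ Ψ)
    (x₀ : O) (h : ∀ y ∈ (O : Set E4), ‖𝓣.framedDeviation 𝔉 Ψ x₀ y‖ < 1)
    {z₁ : O} (h₁ : 𝓣.timeOrientation.IsFutureDirected
      (mfderiv 𝓘(ℝ, E4) (𝓡 4) Ψ z₁ (𝔉.Ainv z₁ (E4.basisVector 0)))) (z : O) :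
    𝓣.timeOrientation.IsFutureDirected (mfderiv 𝓘(ℝ, E4) (𝓡 4) Ψ z (𝔉.Ainv z (E4.basisVector 0))) := by
  set ψ : E4 → 𝓣.carrier := Ψ ∘ (chartAt E4 z₁).symm with hψdef
  have hψ : ContMDiffOn 𝓘(ℝ, E4) (𝓡 4) ∞ ψ O :=
    𝓣.contMDiffOn_comp_chartAt_symm (Minkowski.backgroundOn O) Ψ z₁ hΨ
  let V : E4 → E4 := fun y ↦ 𝔉.Ainv y (E4.basisVector 0)
  have hV : ContinuousOn V O := 𝔉.contDiffOn_Ainv.continuousOn.clm_apply continuousOn_const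
  have hd : ∀ (w : O), mfderiv 𝓘(ℝ, E4) (𝓡 4) ψ (w : E4) (V w) =
      mfderiv 𝓘(ℝ, E4) (𝓡 4) Ψ w (V w) := fun w ↦
    𝓣.mfderiv_comp_chartAt_symm_apply (Minkowski.backgroundOn O) Ψ z₁ w.2
      ((hΨ w).mdifferentiableAt (by simp)) _
  have hc : ∀ y ∈ (O : Set E4), 𝓣.metric.IsCausal (mfderiv 𝓘(ℝ, E4) (𝓡 4) ψ y (V y)) :=
    fun y hy ↦ (𝓣.isTimelike_mfderiv_Ainv_basisVector_zero_of_norm_framed_sub_lt_one 𝔉 (h y hy)).isCausal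
  have hiff : ∀ w : O,
      (𝓣.timeOrientation.IsFutureDirected (mfderiv 𝓘(ℝ, E4) (𝓡 4) ψ (w : E4) (V w)) ↔
        𝓣.timeOrientation.IsFutureDirected (mfderiv 𝓘(ℝ, E4) (𝓡 4) Ψ w (V w))) := by
    intro w
    have hp : (chartAt E4 z₁).symm (w : E4) = w := Subtype.ext (OpensChart.chartAt_symm_val z₁ w.2)
    rw [hd w]
    show 𝓣.timeOrientation.IsFutureDirected (x := Ψ ((chartAt E4 z₁).symm (w : E4))) _ ↔ _
    rw [hp]
  have key := 𝓣.isFutureDirected_mfderiv_apply_of_isPreconnected O.2 hψ hO subset_rfl V hV hc z₁.2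
    ((hiff z₁).2 h₁) z z.2
  exact (hiff z).1 key

end Spacetime

end Literature.Geometry.Lorentzian

end
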